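import Summits.NavierStokesRegularity.FluidComputer.PalasekTowerRegisterGlobalTail

/-!
# REGISTER v2.3′: the heredity ladder of `EpisodeInductionG` — first rung, generic levels, the two halves

Cell `ns-blowup`, seat `ns-blowup-ecbridge-1` (g3); companion of `PalasekTowerRegisterGlobal.lean`
(p411629: the items of record `EpisodeBaseG` / `EpisodeInductionG` of the route
`PalasekTowerBreakdown`, items stmt-NavierStokesRegularity-19179 / -19178) and
`PalasekTowerRegisterGlobalTail.lean` (p412736: the rung ladder `RungG K`). LABEL: E–C typing (KERNEL
vocabulary; NAMED open `Prop`s that truncate / decompose the crux + their interlocks, every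
implication proved). WHAT THIS IS NOT: not Navier–Stokes evidence — no stage, tower or instance is
constructed or claimed; the `@[conjecture]` definitions are never asserted.

## Why (planner ns-blowup-plan g16, BC3 birth skeleton `EpisodeInductionG_birth.lean` 481edd771cc84037, STATUS l.1566 / l.1605)

The crux K2G `EpisodeInductionG` («every globally anchored registered stage at level `k ≥ 1` of a
pinned rigid quiet schedule extends to level `k + 1`») is a conjunction over the levels. The planner's
birth skeleton splits it into the FIRST RUNG `HeredityAtOne` (the hand-over `1 → 2`,
`N₁ = 256^{1.1} ≈ 445 → N₂ ≈ 819` — the BC5 plan-only witness-of-weakness target) and, at the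
generic levels `k ≥ 2`, an UPPER half `ContinuationEnvelope` (classical finite-energy continuation to
the next readout inside the next ceiling) and a LOWER half `ReadoutFloors` (the three floors of level
`k + 1` at its readout, for every such continuation). This module puts those statements IN THE TREE
by name, so that support items can cite declarations rather than a cell workfile, and proves the
bookkeeping around them:

* §1 `HeredityAt k` / `HeredityFrom k₀` (heredity at one level / at all levels `≥ k₀`);
  `episodeInductionG_iff_heredityFrom_one : EpisodeInductionG ↔ HeredityFrom 1` (`Iff.rfl`),
  the peeling `heredityFrom_iff : HeredityFrom k₀ ↔ HeredityAt k₀ ∧ HeredityFrom (k₀ + 1)`,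
  monotonicity, and `HeredityAtOne` (verbatim the skeleton's stub, `= HeredityAt 1` by `Iff.rfl`) with
  `episodeInductionG_iff_heredityAtOne_and_heredityFrom_two` — the skeleton's case split `k = 1` /
  `k ≥ 2` as an EQUIVALENCE (so the split loses nothing).
* §2 rungs: `RungG k → HeredityAt k → RungG (k + 1)`; `EpisodeBaseG → HeredityAtOne → RungG 2` (the
  BC5 rung of record follows from the base and the first heredity); `HeredityFrom 1` with the base
  gives every rung (this is `rungG_of_episodesG`).
* §3 the two halves at the generic levels, `ContinuationEnvelope` and `ReadoutFloors` (the skeleton's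
  statements; `ReadoutFloors` here also lists the continuation's FINITE ENERGY among its hypotheses —
  the envelope supplies it, so the composition is unchanged, and without it the floors would be asked
  of infinite-energy Galilean relabellings `u(t, x - ∫a) + a(t)` of a continuation, which no design
  controls), the composition `heredityFrom_two_of_envelope_floors` and
  `episodeInductionG_of_rung_envelope_floors : HeredityAtOne → ContinuationEnvelope → ReadoutFloors →
  EpisodeInductionG` (the skeleton's `EpisodeInductionG_of`, kernel-checked here against the landed
  register), and the free converse `ContinuationEnvelope.of_heredityFrom_two` (the upper half IS a
  consequence of the crux; the lower half is one modulo uniqueness of classical finite-energy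
  continuations on the unforced window — not typed here).

References: S. Palasek, arXiv:2605.13827 §3.3–§4 [cite: Palasek2026ElementaryModel, §4];
C. L. Fefferman, Clay problem description, (C) [cite: FeffermanClay2006, (C)].
-/

noncomputable section

namespace Summit.NavierStokesRegularity.FluidComputer.PalasekTowerClayBridge

open Set MeasureTheory Filter Topology Function Real
open scoped ENNReal ContDiff NNReal
open Literature.Analysis.FluidPDE

/-! ## §1 Heredity level by level -/

/-- **Heredity AT level `k`** of the v2.3′ register (open for every `k ≥ 1`; never asserted): every
globally anchored registered stage at level `k` of a pinned (`Λ = 8`, `θ = 6/5`), rigid, quiet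
schedule on the wide-base rates extends to one at level `k + 1`, at unit viscosity — the hand-over
`k → k + 1` alone. [cite: Palasek2026ElementaryModel, §4] -/
@[conjecture] def HeredityAt (k : ℕ) : Prop :=
  ∀ S : Schedule TowerRates.wide, S.Pins 8 (6 / 5) → S.Rigid → S.Quiet →
    ∀ s : Stage 1 TowerRates.wide S (Margins.routeG TowerRates.wide) k,
      ∃ s' : Stage 1 TowerRates.wide S (Margins.routeG TowerRates.wide) (k + 1), s.Extends s'

/-- **Heredity FROM level `k₀` on** (open; never asserted): heredity at every level `k ≥ k₀`.
`HeredityFrom 1` is K2G `EpisodeInductionG` verbatim. [cite: Palasek2026ElementaryModel, §4] -/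
@[conjecture] def HeredityFrom (k₀ : ℕ) : Prop :=
  ∀ S : Schedule TowerRates.wide, S.Pins 8 (6 / 5) → S.Rigid → S.Quiet → ∀ k : ℕ, k₀ ≤ k →
    ∀ s : Stage 1 TowerRates.wide S (Margins.routeG TowerRates.wide) k,
      ∃ s' : Stage 1 TowerRates.wide S (Margins.routeG TowerRates.wide) (k + 1), s.Extends s'

/-- K2G of record IS heredity from level `1` (definitionally). [folklore] -/
theorem episodeInductionG_iff_heredityFrom_one : EpisodeInductionG ↔ HeredityFrom 1 := Iff.rfl

/-- Heredity from `k₀` contains heredity at every level `k ≥ k₀`. [folklore] -/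
theorem HeredityFrom.heredityAt {k₀ k : ℕ} (h : HeredityFrom k₀) (hk : k₀ ≤ k) : HeredityAt k :=
  fun S hP hR hQ s => h S hP hR hQ k hk s

/-- Heredity from a level is monotone: from `k₀` implies from any later `k₁ ≥ k₀`. [folklore] -/
theorem HeredityFrom.mono {k₀ k₁ : ℕ} (h : HeredityFrom k₀) (hk : k₀ ≤ k₁) : HeredityFrom k₁ :=
  fun S hP hR hQ k hk' s => h S hP hR hQ k (hk.trans hk') s

/-- **Peeling one level**: heredity from `k₀` is heredity at `k₀` together with heredity from
`k₀ + 1`. [folklore] -/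
theorem heredityFrom_iff (k₀ : ℕ) : HeredityFrom k₀ ↔ HeredityAt k₀ ∧ HeredityFrom (k₀ + 1) := by
  constructor
  · exact fun h => ⟨h.heredityAt le_rfl, h.mono (Nat.le_succ k₀)⟩
  · rintro ⟨h₀, h₁⟩ S hP hR hQ k hk s
    rcases hk.eq_or_lt with rfl | hlt
    · exact h₀ S hP hR hQ s
    · exact h₁ S hP hR hQ k hlt s

/-- Heredity at all levels of a finite range glues: at `k₀` and from `k₀ + 1` gives from `k₀`.
[folklore] -/
theorem HeredityAt.heredityFrom {k₀ : ℕ} (h₀ : HeredityAt k₀) (h₁ : HeredityFrom (k₀ + 1)) :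
    HeredityFrom k₀ :=
  (heredityFrom_iff k₀).2 ⟨h₀, h₁⟩

/-- **The FIRST RUNG of the crux** (open; never asserted; the route's BC5 plan-only target, planner BC3
stub `heredity_at_one` verbatim): every globally anchored registered stage at level `1` of a pinned,
rigid, quiet schedule on the wide-base rates extends to one at level `2` — the hand-over `1 → 2`
(`N₁ = 256^{1.1} ≈ 445 → N₂ ≈ 819`, window `c₅ log N₂ / A₁`, unit viscosity, no force after `τ 1`).
[cite: Palasek2026ElementaryModel, §4] -/
@[conjecture] def HeredityAtOne : Prop :=
  ∀ S : Schedule TowerRates.wide, S.Pins 8 (6 / 5) → S.Rigid → S.Quiet →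
    ∀ s : Stage 1 TowerRates.wide S (Margins.routeG TowerRates.wide) 1,
      ∃ s' : Stage 1 TowerRates.wide S (Margins.routeG TowerRates.wide) 2, s.Extends s'

/-- The first rung is heredity at level `1` (definitionally). [folklore] -/
theorem heredityAtOne_iff : HeredityAtOne ↔ HeredityAt 1 := Iff.rfl

/-- **The first rung IS a truncation of the crux** (so a proof of it is a witness of weakness OF
`EpisodeInductionG`, not of something else; the skeleton's `heredityAtOne_of_episodeInductionA`).
[folklore] -/
theorem EpisodeInductionG.heredityAtOne (h : EpisodeInductionG) : HeredityAtOne :=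
  (episodeInductionG_iff_heredityFrom_one.1 h).heredityAt le_rfl

/-- The crux also contains heredity from every level `k₀ ≥ 1`. [folklore] -/
theorem EpisodeInductionG.heredityFrom (h : EpisodeInductionG) {k₀ : ℕ} (hk : 1 ≤ k₀) :
    HeredityFrom k₀ :=
  (episodeInductionG_iff_heredityFrom_one.1 h).mono hk

/-- **The skeleton's case split is lossless**: K2G ⇔ (first rung) ∧ (heredity from level `2`).
[folklore] -/
theorem episodeInductionG_iff_heredityAtOne_and_heredityFrom_two :
    EpisodeInductionG ↔ HeredityAtOne ∧ HeredityFrom 2 :=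
  episodeInductionG_iff_heredityFrom_one.trans (heredityFrom_iff 1)

/-! ## §2 Heredity and the rung ladder -/

/-- Heredity at level `k` lifts rung `k` to rung `k + 1` (same schedule, extended stage). [folklore] -/
theorem RungG.succ_of_heredityAt {k : ℕ} (hK : RungG k) (h : HeredityAt k) : RungG (k + 1) := by
  obtain ⟨S, hP, hR, hQ, ⟨s⟩⟩ := hK
  obtain ⟨s', -⟩ := h S hP hR hQ s
  exact ⟨S, hP, hR, hQ, ⟨s'⟩⟩

/-- **The BC5 rung of record from the base and the first heredity**: `EpisodeBaseG → HeredityAtOne →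
RungG 2`. [folklore] -/
theorem rungG_two_of_heredityAtOne (h₁ : EpisodeBaseG) (h : HeredityAtOne) : RungG 2 :=
  (rungG_one_iff.2 h₁).succ_of_heredityAt (heredityAtOne_iff.1 h)

/-- Heredity from level `1` up to depth `K` carries the base to rung `K + 1` (finite iteration; with
`HeredityFrom 1 = EpisodeInductionG` this is `rungG_of_episodesG`). [folklore] -/
theorem rungG_succ_of_heredityFrom_one (h₁ : EpisodeBaseG) (h : HeredityFrom 1) (K : ℕ) :
    RungG (K + 1) := by
  induction K with
  | zero => exact rungG_one_iff.2 h₁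
  | succ K ih => exact ih.succ_of_heredityAt (h.heredityAt (Nat.succ_pos K))

/-! ## §3 The two halves at the generic levels `k ≥ 2` -/

/-- **UPPER half at the generic levels — the continuation envelope** (open; never asserted; planner
BC3 stub `continuation_envelope` verbatim): every globally anchored registered stage at level `k ≥ 2`
of a pinned, rigid, quiet schedule continues as a classical solution (force `S.f`, which vanishes
after `τ 1`) to the next readout `τ (k+1)`, with finite energy on `[0, τ (k+1)]` and inside the next
ceiling `c₂ Y_{k+1}` there — no premature blow-up, no overshoot. [cite: Palasek2026ElementaryModel, §4] -/
@[conjecture] def ContinuationEnvelope : Prop :=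
  ∀ S : Schedule TowerRates.wide, S.Pins 8 (6 / 5) → S.Rigid → S.Quiet → ∀ k : ℕ, 2 ≤ k →
    ∀ s : Stage 1 TowerRates.wide S (Margins.routeG TowerRates.wide) k,
      ∃ (u : ℝ → EuclideanSpace ℝ (Fin 3) → EuclideanSpace ℝ (Fin 3))
        (p : ℝ → EuclideanSpace ℝ (Fin 3) → ℝ),
        IsClassicalNSSolutionOn (Icc 0 (S.τ (k + 1))) 1 S.f u p ∧
        (∀ t ∈ Icc 0 (S.τ k), u t = s.u t ∧ p t = s.p t) ∧
        (∃ C : ℝ≥0∞, C < ⊤ ∧ ∀ t ∈ Icc 0 (S.τ (k + 1)), ∫⁻ x, ‖u t x‖ₑ ^ 2 ≤ C) ∧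
        (∀ t ∈ Icc 0 (S.τ (k + 1)), ∀ x, ‖u t x‖ ≤ S.c₂ * TowerRates.wide.Y (k + 1))

/-- **LOWER half at the generic levels — the readout floors (autonomous compaction)** (open; never
asserted; planner BC3 stub `readout_floors` with the continuation's finite energy listed among the
hypotheses): for every pinned, rigid, quiet schedule, every globally anchored registered stage at
level `k ≥ 2` and EVERY classical finite-energy continuation of it to `τ (k+1)` inside the next
ceiling, the three floors of level `k + 1` hold at `τ (k+1)` inside the ball: the velocity floor
`c₁ Y_{k+1}`, the strain floor `c₁ A_{k+1}`, and the core ledger (a `C¹` loop of speed `≤ 8π/N_{k+1}`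
in a ball of radius `1/N_{k+1}` with circulation `≥ c₁ N_{k+1}^{β-2}`).
[cite: Palasek2026ElementaryModel, §4] -/
@[conjecture] def ReadoutFloors : Prop :=
  ∀ S : Schedule TowerRates.wide, S.Pins 8 (6 / 5) → S.Rigid → S.Quiet → ∀ k : ℕ, 2 ≤ k →
    ∀ s : Stage 1 TowerRates.wide S (Margins.routeG TowerRates.wide) k,
    ∀ (u : ℝ → EuclideanSpace ℝ (Fin 3) → EuclideanSpace ℝ (Fin 3))
      (p : ℝ → EuclideanSpace ℝ (Fin 3) → ℝ),
      IsClassicalNSSolutionOn (Icc 0 (S.τ (k + 1))) 1 S.f u p →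
      (∀ t ∈ Icc 0 (S.τ k), u t = s.u t ∧ p t = s.p t) →
      (∃ C : ℝ≥0∞, C < ⊤ ∧ ∀ t ∈ Icc 0 (S.τ (k + 1)), ∫⁻ x, ‖u t x‖ₑ ^ 2 ≤ C) →
      (∀ t ∈ Icc 0 (S.τ (k + 1)), ∀ x, ‖u t x‖ ≤ S.c₂ * TowerRates.wide.Y (k + 1)) →
      (∃ x, ‖x‖ ≤ S.radius ∧ S.c₁ * TowerRates.wide.Y (k + 1) ≤ ‖u (S.τ (k + 1)) x‖) ∧
      (∃ x, ‖x‖ ≤ S.radius ∧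
        S.c₁ * TowerRates.wide.A (k + 1) ≤ ‖fderiv ℝ (u (S.τ (k + 1))) x‖) ∧
      (∃ (x : EuclideanSpace ℝ (Fin 3)) (γ : ℝ → EuclideanSpace ℝ (Fin 3)),
        ‖x‖ ≤ S.radius ∧ ContDiff ℝ 1 γ ∧ γ 0 = γ 1 ∧
        (∀ σ ∈ Icc (0 : ℝ) 1, γ σ ∈ Metric.closedBall x (1 / TowerRates.wide.N (k + 1))) ∧
        (∀ σ ∈ Icc (0 : ℝ) 1, ‖deriv γ σ‖ ≤ 8 * π / TowerRates.wide.N (k + 1)) ∧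
        S.c₁ * TowerRates.wide.N (k + 1) ^ (TowerRates.wide.β - 2) ≤
          circulation (u (S.τ (k + 1))) γ)

/-- Under rigidity the growth window `c₅ log N_{k+1} / A_k` is a nonnegative length. [folklore] -/
theorem Schedule.Rigid.window_nonneg_wide {S : Schedule TowerRates.wide} (h : S.Rigid) (k : ℕ) :
    0 ≤ S.c₅ * Real.log (TowerRates.wide.N (k + 1)) / TowerRates.wide.A k := by
  have h1 : 0 < S.c₅ := by
    rw [h.c₅_eq]
    have hb := TowerRates.wide.one_lt_b
    have hβ := TowerRates.wide.two_lt_β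
    positivity
  have h2 : 0 < Real.log (TowerRates.wide.N (k + 1)) := Real.log_pos (TowerRates.wide.one_lt_N _)
  have h3 : 0 < TowerRates.wide.A k := TowerRates.wide.A_pos k
  positivity

/-- **Assembling a stage at level `k + 1` from a continuation with the envelope and the floors**
(the construction inside the skeleton's `EpisodeInductionG_of`, for any `k`): a classical
finite-energy continuation of a registered stage to `τ (k+1)`, inside the next ceiling and meeting
the three floors of level `k + 1` at `τ (k+1)`, IS a registered stage at level `k + 1` extending it —
the earlier floors / ceilings / quiet clauses / strain floors / core loops are read off the old stage
through the agreement on `[0, τ k]`, the quiet clause of the new level is the old top ceiling by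
window equality, rigidity is schedule data, and the global anchor (a `[0, τ 0)` clause) is inherited
along the agreement. [folklore] -/
theorem Stage.nonempty_extends_of_continuation {S : Schedule TowerRates.wide} (hrig : S.Rigid) {k : ℕ}
    (s : Stage 1 TowerRates.wide S (Margins.routeG TowerRates.wide) k)
    {u : ℝ → EuclideanSpace ℝ (Fin 3) → EuclideanSpace ℝ (Fin 3)}
    {p : ℝ → EuclideanSpace ℝ (Fin 3) → ℝ}
    (hcl : IsClassicalNSSolutionOn (Icc 0 (S.τ (k + 1))) 1 S.f u p)
    (hagree : ∀ t ∈ Icc 0 (S.τ k), u t = s.u t ∧ p t = s.p t)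
    (henergy : ∃ C : ℝ≥0∞, C < ⊤ ∧ ∀ t ∈ Icc 0 (S.τ (k + 1)), ∫⁻ x, ‖u t x‖ₑ ^ 2 ≤ C)
    (hceil : ∀ t ∈ Icc 0 (S.τ (k + 1)), ∀ x, ‖u t x‖ ≤ S.c₂ * TowerRates.wide.Y (k + 1))
    (hfloor : ∃ x, ‖x‖ ≤ S.radius ∧ S.c₁ * TowerRates.wide.Y (k + 1) ≤ ‖u (S.τ (k + 1)) x‖)
    (hstrain : ∃ x, ‖x‖ ≤ S.radius ∧
      S.c₁ * TowerRates.wide.A (k + 1) ≤ ‖fderiv ℝ (u (S.τ (k + 1))) x‖)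
    (hcore : ∃ (x : EuclideanSpace ℝ (Fin 3)) (γ : ℝ → EuclideanSpace ℝ (Fin 3)),
      ‖x‖ ≤ S.radius ∧ ContDiff ℝ 1 γ ∧ γ 0 = γ 1 ∧
      (∀ σ ∈ Icc (0 : ℝ) 1, γ σ ∈ Metric.closedBall x (1 / TowerRates.wide.N (k + 1))) ∧
      (∀ σ ∈ Icc (0 : ℝ) 1, ‖deriv γ σ‖ ≤ 8 * π / TowerRates.wide.N (k + 1)) ∧
      S.c₁ * TowerRates.wide.N (k + 1) ^ (TowerRates.wide.β - 2) ≤ circulation (u (S.τ (k + 1))) γ) :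
    ∃ s' : Stage 1 TowerRates.wide S (Margins.routeG TowerRates.wide) (k + 1), s.Extends s' := by
  have hm : (∀ j, j ≤ k → ∃ x, ‖x‖ ≤ S.radius ∧
      S.c₁ * TowerRates.wide.A j ≤ ‖fderiv ℝ (s.u (S.τ j)) x‖) ∧
      (S.AnchorGlobal s.u ∧ (S.Rigid ∧ CoreLedger TowerRates.wide S k s.u)) := s.margin
  obtain ⟨hstrain_old, hanch, -, hcore_old⟩ := hm
  -- agreement at the old readout times and on the old slab
  have hag : ∀ j, j ≤ k → u (S.τ j) = s.u (S.τ j) := fun j hj =>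
    (hagree (S.τ j) ⟨(S.τ_pos j).le, S.τ_mono hj⟩).1
  have hag' : ∀ t, t ∈ Icc 0 (S.τ k) → u t = s.u t := fun t ht => (hagree t ht).1
  refine ⟨{ u := u, p := p, classical := hcl, initial := ?_, energy := henergy, floor := ?_,
            ceiling := ?_, quiet := ?_, margin := ?_ }, fun t ht => hagree t ht⟩
  · -- initial
    rw [hag' 0 ⟨le_rfl, (S.τ_pos k).le⟩]
    exact s.initial
  · -- floors
    intro j hj
    rcases Nat.lt_or_ge j (k + 1) with h | h
    · have hjk : j ≤ k := Nat.lt_succ_iff.mp h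
      rw [hag j hjk]
      exact s.floor j hjk
    · have hj' : j = k + 1 := le_antisymm hj h
      subst hj'
      exact hfloor
  · -- ceilings
    intro j hj t ht x
    rcases Nat.lt_or_ge j (k + 1) with h | h
    · have hjk : j ≤ k := Nat.lt_succ_iff.mp h
      rw [hag' t ⟨ht.1, ht.2.trans (S.τ_mono hjk)⟩]
      exact s.ceiling j hjk t ht x
    · have hj' : j = k + 1 := le_antisymm hj h
      subst hj'
      exact hceil t ht x
  · -- quiet
    intro j hj t ht x
    rcases Nat.lt_or_ge (j + 1) (k + 1) with h | h
    · have hjk : j + 1 ≤ k := Nat.lt_succ_iff.mp h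
      have hw := hrig.window_nonneg_wide j
      rw [hag' t ⟨ht.1, by linarith [ht.2, S.τ_mono hjk]⟩]
      exact s.quiet j hjk t ht x
    · have hj' : j = k := by omega
      subst hj'
      have ht' : t ∈ Icc 0 (S.τ j) := ⟨ht.1, by have := hrig.window_eq j; linarith [ht.2]⟩
      rw [hag' t ht']
      exact s.ceiling j le_rfl t ht' x
  · -- margin: strain floors ∧ (global anchor ∧ (rigidity ∧ core ledger)); the anchor is inherited
    show (∀ j, j ≤ k + 1 → ∃ x, ‖x‖ ≤ S.radius ∧
      S.c₁ * TowerRates.wide.A j ≤ ‖fderiv ℝ (u (S.τ j)) x‖) ∧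
      (S.AnchorGlobal u ∧ (S.Rigid ∧ CoreLedger TowerRates.wide S (k + 1) u))
    refine ⟨?_, hanch.congr (k := k) hag', hrig, ?_⟩
    · intro j hj
      rcases Nat.lt_or_ge j (k + 1) with h | h
      · have hjk : j ≤ k := Nat.lt_succ_iff.mp h
        rw [hag j hjk]
        exact hstrain_old j hjk
      · have hj' : j = k + 1 := le_antisymm hj h
        subst hj'
        exact hstrain
    · intro j hj
      rcases Nat.lt_or_ge j (k + 1) with h | h
      · have hjk : j ≤ k := Nat.lt_succ_iff.mp h
        rw [hag j hjk]
        exact hcore_old j hjk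
      · have hj' : j = k + 1 := le_antisymm hj h
        subst hj'
        exact hcore

/-- **The two halves compose to heredity from level `2`** (generic levels). [folklore] -/
theorem heredityFrom_two_of_envelope_floors (hA : ContinuationEnvelope) (hB : ReadoutFloors) :
    HeredityFrom 2 := by
  intro S hP hRig hQ k hk s
  obtain ⟨u, p, hcl, hagree, henergy, hceil⟩ := hA S hP hRig hQ k hk s
  obtain ⟨hfloor, hstrain, hcore⟩ := hB S hP hRig hQ k hk s u p hcl hagree henergy hceil
  exact s.nonempty_extends_of_continuation hRig hcl hagree henergy hceil hfloor hstrain hcore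

/-- **The composition of the BC3 birth skeleton, kernel-checked against the landed register**: first
rung + (upper envelope + readout floors at the generic levels) ⇒ K2G `EpisodeInductionG`.
[folklore] -/
theorem episodeInductionG_of_rung_envelope_floors (hR : HeredityAtOne) (hA : ContinuationEnvelope)
    (hB : ReadoutFloors) : EpisodeInductionG :=
  episodeInductionG_iff_heredityAtOne_and_heredityFrom_two.2
    ⟨hR, heredityFrom_two_of_envelope_floors hA hB⟩

/-- **The upper half IS a consequence of the crux** (free converse): heredity from level `2` yields,
for every registered stage at level `k ≥ 2`, the extension stage's own velocity and pressure as a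
continuation with finite energy inside the next ceiling. (The lower half `ReadoutFloors` quantifies
over EVERY finite-energy continuation inside the ceiling; it follows from the crux only together with
uniqueness of classical finite-energy continuations on the — unforced, by `Quiet` — window, which is
not typed here.) [folklore] -/
theorem ContinuationEnvelope.of_heredityFrom_two (h : HeredityFrom 2) : ContinuationEnvelope := by
  intro S hP hR hQ k hk s
  obtain ⟨s', hs'⟩ := h S hP hR hQ k hk s
  exact ⟨s'.u, s'.p, s'.classical, hs', s'.energy,
    fun t ht x => s'.ceiling (k + 1) le_rfl t ht x⟩

/-- Hence the crux itself yields the continuation envelope. [folklore] -/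
theorem EpisodeInductionG.continuationEnvelope (h : EpisodeInductionG) : ContinuationEnvelope :=
  ContinuationEnvelope.of_heredityFrom_two (h.heredityFrom (by norm_num))

end Summit.NavierStokesRegularity.FluidComputer.PalasekTowerClayBridge

end
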